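import Literature.AnabelianGeometry.SemiGraphs.TemperedSeparatingOverInfiniteValence
import Literature.AnabelianGeometry.SemiGraphs.TemperedHbddOfLocallyFinite
import Literature.AnabelianGeometry.SemiGraphs.TemperedCompactCentralizerInVerticial
import HarnessLib

/-!
# [SemiAnbd] Thm 3.7 (iii) / Cor 3.9 (R3c) beyond locally finite `𝔾`: the binder `hbdd` — hence (FIX∞).hadj and
# F-2772 `EdgeLikeCentralizerAt` — at every TAME graph (vertices of infinite valence allowed; every star)

Mochizuki, *Semi-graphs of anabelioids*, Publ. RIMS **42** (2006), §3, Theorem 3.7 (iii), manuscript p. 41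
("if `H` fixes two vertices of `𝒢_{∞,j}`, then these two vertices are joined to one another by a single edge")
and Corollary 3.9, proof p. 43 l. 13 ("[again by Theorem 3.7, (iii), (iv)]" — the step the cell names (R3c)
`EdgeLikeCentralizerAt` / `EdgeLikeCentralizer`, FACT-LIST rows F-2772 / F-2773)
[cite: MochizukiSemiAnbd2006, Cor 3.9 p.43].

PROOF-ONLY (cell abc-iut, block F, seat abc-iut-f-176 gen 3; desk memo
`HOME/staging/f/f-176/g3/FINDING-hadj-tame.md`; no definition, no new named fact; the custody files
`TemperedReconstructionR3Sub.lean`, `TemperedVerticial.lean`, `TemperedLevelData.lean` are untouched).  The locally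
finite case is abc-iut-w6-d062's `hbdd_temperedPiChart_of_isLocallyFinite` / abc-iut-f-172's
`edgeLikeCentralizerAt_of_isLocallyFinite`; here vertices of INFINITE valence are allowed:

* `leFinset_temperedPiChart` — abc-iut-w6-d062's two depth lemmas (`eventually_fold_same_base_pair`,
  `eventually_not_fixed_pair_of_ne_base_pair`; uniform over compatible point sequences, and every tree vertex lies
  under one, `exists_pointSeq_vertex_eq_galoisLevelData`) MERGED over a FINITE set of base branches at a base vertex
  of ANY valence, at the canonical tower `verticialLevelData_temperedPiChart`, for every subgroup `C ≠ 1`;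
* **`hbdd_temperedPiChart_of_tame`** (`VerticialLevelData.hbdd_of_tame` of
  `TemperedSeparatingOverInfiniteValence.lean`) and **`hadj_temperedPiChart_of_tame`** (abc-iut-L3-t10's
  `hadj_temperedPiChart_of_bounded_dist'`) — at every `𝒢` satisfying the hypotheses of Thm 3.7 that is TAME:
  every vertex of infinite valence has only finitely many branches whose edge has ANOTHER branch abutting a vertex
  of infinite valence, and finitely many whose edge has another branch abutting any given vertex (every STAR — one
  vertex of any valence joined by simple edges to vertices of finite valence, no loop at it —, every graph whose
  infinite-valence vertices are pairwise non-adjacent, loop-free and of finite edge multiplicity, every locally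
  finite graph);
* **`centralizer_le_verticial_of_tame`** — the centraliser of every compact `C ≠ 1` lies in each of its verticial
  hosts, EVERY chart (abc-iut-f-172's `centralizer_le_of_hadj`, transported as in
  `centralizer_le_verticial_of_isLocallyFinite`);
* **`edgeLikeCentralizerAt_of_tame`** — (R3c) F-2772 `EdgeLikeCentralizerAt ℋ c` at EVERY chart of EVERY TAME
  graph of anabelioids satisfying the hypotheses of Cor. 3.9; `edgeLikeCentralizerAt_of_isolated_infiniteValence`
  (the simplest TAME shape spelled out); **`edgeLikeCentralizer_of_tame`** — the frozen ∀-fact F-2773 RESTRICTED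
  to TAME graphs, hypothesis-free.

Honest framing: statements about OUR typed tempered fundamental groups; the bare ∀-closure of F-2773 over graphs
with an infinitely-branching core (every vertex of some sub-semi-graph of infinite valence in it, e.g. the
ℵ₀-regular tree) is NOT claimed; cone-irrelevant beyond finite dual graphs; no side taken on [IUTchIII] Cor. 3.12;
typed ≠ proved elsewhere.
-/

namespace Literature.AnabelianGeometry.SemiGraphs

namespace ProfiniteSemiGraph

/-! ### The canonical tower: the merged depth lemma at any valence, and the TAME theorems -/

section Canonical

open CategoryTheory Topology

universe u

variable (𝒢 : ProfiniteSemiGraph.{u}) {ℋ : ProfiniteSemiGraph.{u}}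

/-- **The two depth lemmas merged over a FINITE branch set, at the canonical tower, ANY valence** (the binder `hLE`
of `VerticialLevelData.dist_le_four_of_tame` at `verticialLevelData_temperedPiChart`): for a subgroup `C ≠ 1`, a
base vertex `w`, a finite set `B` of branches at `w` and a reference level `j`, there is a level `k ≥ j` at which,
at every tree vertex over `w`, two `C`-fixed tree branches with base branches in `B` have the same image in
`𝔾̃_j` — abc-iut-w6-d062's `eventually_fold_same_base_pair` (same base branch) maximised over `B` and
`eventually_not_fixed_pair_of_ne_base_pair` (distinct base branches) maximised over `B × B`, for one `c ≠ 1` of `C`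
(`exists_proj_ne_one`), at the point sequence through the vertex (`exists_pointSeq_vertex_eq_galoisLevelData`).
[cite: MochizukiSemiAnbd2006, Thm 3.7(iii) p.41] -/
theorem leFinset_temperedPiChart (h37 : 𝒢.Thm37Hypotheses)
    (C : Subgroup (𝒢.temperedPiChart h37.toProp36Hypotheses).G) (hC : C ≠ ⊥)
    (w : 𝒢.graph.Vertex) (B : Set 𝒢.graph.Branch) (hB : B.Finite) (hBw : ∀ b ∈ B, 𝒢.graph.abuts b = some w)
    (j : ℕ) :
    ∃ (k : ℕ) (hjk : j ≤ k), ∀ (v : ((𝒢.galoisLevelData h37.toProp36Hypotheses).tree k).Vertex),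
      ((𝒢.galoisLevelData h37.toProp36Hypotheses).treeProj k).vertexMap v = w →
      ∀ (β₁ β₂ : ((𝒢.galoisLevelData h37.toProp36Hypotheses).tree k).Branch),
      ((𝒢.galoisLevelData h37.toProp36Hypotheses).tree k).abuts β₁ = some v →
      ((𝒢.galoisLevelData h37.toProp36Hypotheses).tree k).abuts β₂ = some v →
      ((𝒢.galoisLevelData h37.toProp36Hypotheses).treeProj k).branchMap β₁ ∈ B →
      ((𝒢.galoisLevelData h37.toProp36Hypotheses).treeProj k).branchMap β₂ ∈ B →
      (∀ g ∈ C, ((𝒢.galoisLevelData h37.toProp36Hypotheses).treeAct h37.toProp36Hypotheses.isCountable k g).hom.edgeMap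
          (((𝒢.galoisLevelData h37.toProp36Hypotheses).tree k).edgeOf β₁) =
        ((𝒢.galoisLevelData h37.toProp36Hypotheses).tree k).edgeOf β₁) →
      (∀ g ∈ C, ((𝒢.galoisLevelData h37.toProp36Hypotheses).treeAct h37.toProp36Hypotheses.isCountable k g).hom.edgeMap
          (((𝒢.galoisLevelData h37.toProp36Hypotheses).tree k).edgeOf β₂) =
        ((𝒢.galoisLevelData h37.toProp36Hypotheses).tree k).edgeOf β₂) →
      ((𝒢.galoisLevelData h37.toProp36Hypotheses).treeTrans hjk).branchMap β₁ =
        ((𝒢.galoisLevelData h37.toProp36Hypotheses).treeTrans hjk).branchMap β₂ := by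
  classical
  -- a non-trivial element of `C` and a level where it is non-trivial
  obtain ⟨c, hcC, hc1⟩ : ∃ c ∈ C, c ≠ 1 := by
    by_contra h
    exact hC ((Subgroup.eq_bot_iff_forall C).mpr fun x hx => by
      by_contra hx1
      exact h ⟨x, hx, hx1⟩)
  obtain ⟨j₀, hc⟩ := 𝒢.exists_proj_ne_one h37.toProp36Hypotheses c hc1
  haveI : Finite B := hB.to_subtype
  -- same base branch: one fold level per branch of `B`
  have hkf := fun b₀ : B => 𝒢.eventually_fold_same_base_pair h37 c j₀ hc w (hBw b₀.1 b₀.2) j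
  choose kf hkf using hkf
  obtain ⟨Kf, hKf⟩ := (Set.finite_range kf).bddAbove
  -- distinct base branches: one exclusion level per pair of distinct branches of `B`
  have hkt := fun pr : {pr : B × B // pr.1.1 ≠ pr.2.1} =>
    𝒢.eventually_not_fixed_pair_of_ne_base_pair h37 c j₀ hc w (hBw pr.1.1.1 pr.1.1.2) (hBw pr.1.2.1 pr.1.2.2) pr.2
  choose kt hkt using hkt
  obtain ⟨Kt, hKt⟩ := (Set.finite_range kt).bddAbove
  refine ⟨max j (max Kf Kt), le_max_left _ _, fun v hv β₁ β₂ hβ₁ hβ₂ hB₁ hB₂ hf₁ hf₂ => ?_⟩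
  obtain ⟨P, hPv⟩ : ∃ P : (𝒢.galoisLevelData h37.toProp36Hypotheses).PointSeq h37.toProp36Hypotheses.isCountable w,
      P.vertex (max j (max Kf Kt)) = v := by
    subst hv
    exact exists_pointSeq_vertex_eq_galoisLevelData h37.toProp36Hypotheses _ v
  rw [← hPv] at hβ₁ hβ₂
  by_cases hbb : ((𝒢.galoisLevelData h37.toProp36Hypotheses).treeProj (max j (max Kf Kt))).branchMap β₁ =
      ((𝒢.galoisLevelData h37.toProp36Hypotheses).treeProj (max j (max Kf Kt))).branchMap β₂
  · -- same base branch: the fold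
    let b₀ : B := ⟨_, hB₁⟩
    have hkle : kf b₀ ≤ max j (max Kf Kt) :=
      (hKf ⟨b₀, rfl⟩).trans ((le_max_left _ _).trans (le_max_right _ _))
    exact (hkf b₀).2.2 _ hkle P β₁ β₂ rfl hbb.symm hβ₁ hβ₂ (hf₁ c hcC) (hf₂ c hcC) (le_max_left _ _)
  · -- distinct base branches: excluded
    let pr : {pr : B × B // pr.1.1 ≠ pr.2.1} := ⟨(⟨_, hB₁⟩, ⟨_, hB₂⟩), hbb⟩
    have hkle : kt pr ≤ max j (max Kf Kt) :=
      (hKt ⟨pr, rfl⟩).trans ((le_max_right _ _).trans (le_max_right _ _))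
    exact ((hkt pr).2 _ hkle P β₁ β₂ rfl rfl hβ₁ hβ₂ (hf₁ c hcC) (hf₂ c hcC)).elim

/-- **`hbdd` (bound `4`) at the canonical tower of a TAME `𝒢`, any valence**: for `𝒢` satisfying the hypotheses
of Thm 3.7 in which every vertex of infinite valence has only finitely many branches whose edge has another branch
abutting a vertex of infinite valence (`hTinf`) and finitely many whose edge has another branch abutting any given
vertex (`hTmul`) — every star, every graph whose infinite-valence vertices are pairwise non-adjacent, loop-free
and of finite edge multiplicity —, any two compatible vertex systems of the canonical tower fixed by a subgroup
`C ≠ 1` are, at every level, equal or the two ends of one edge. [cite: MochizukiSemiAnbd2006, Thm 3.7(iii) p.41] -/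
theorem hbdd_temperedPiChart_of_tame (h37 : 𝒢.Thm37Hypotheses)
    (hTinf : ∀ w : 𝒢.graph.Vertex, {b | 𝒢.graph.abuts b = some w}.Infinite →
      {b : 𝒢.graph.Branch | 𝒢.graph.abuts b = some w ∧ ∃ b', b' ≠ b ∧ 𝒢.graph.edgeOf b' = 𝒢.graph.edgeOf b ∧
        ∃ w', 𝒢.graph.abuts b' = some w' ∧ {b'' | 𝒢.graph.abuts b'' = some w'}.Infinite}.Finite)
    (hTmul : ∀ w a : 𝒢.graph.Vertex, {b | 𝒢.graph.abuts b = some w}.Infinite →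
      {b : 𝒢.graph.Branch | 𝒢.graph.abuts b = some w ∧ ∃ b', b' ≠ b ∧ 𝒢.graph.edgeOf b' = 𝒢.graph.edgeOf b ∧
        𝒢.graph.abuts b' = some a}.Finite)
    (C : Subgroup (𝒢.temperedPiChart h37.toProp36Hypotheses).G) (hC : C ≠ ⊥)
    (x x' : ∀ j, ((verticialLevelData_temperedPiChart (h36 := h37.toProp36Hypotheses)).tree j).Vertex)
    (hx : ∀ ⦃i j : ℕ⦄ (hij : i ≤ j), ((verticialLevelData_temperedPiChart (h36 := h37.toProp36Hypotheses)).trans hij).vertexMap (x j) = x i)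
    (hx' : ∀ ⦃i j : ℕ⦄ (hij : i ≤ j), ((verticialLevelData_temperedPiChart (h36 := h37.toProp36Hypotheses)).trans hij).vertexMap (x' j) = x' i)
    (hfx : ∀ g ∈ C, ∀ j, ((verticialLevelData_temperedPiChart (h36 := h37.toProp36Hypotheses)).act j g).hom.vertexMap (x j) = x j)
    (hfx' : ∀ g ∈ C, ∀ j, ((verticialLevelData_temperedPiChart (h36 := h37.toProp36Hypotheses)).act j g).hom.vertexMap (x' j) = x' j) :
    ∃ N : ℕ, ∀ j, ((verticialLevelData_temperedPiChart (h36 := h37.toProp36Hypotheses)).tree j).subdivision.dist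
      (Sum.inl (x j)) (Sum.inl (x' j)) ≤ N :=
  (verticialLevelData_temperedPiChart (h36 := h37.toProp36Hypotheses)).hbdd_of_tame C
    (fun w B hB hBw j => 𝒢.leFinset_temperedPiChart h37 C hC w B hB hBw j) hTinf hTmul x x' hx hx' hfx hfx'

/-- **(FIX∞).hadj at the canonical tower of a TAME `𝒢`, any valence** (abc-iut-L3-t10's
`hadj_temperedPiChart_of_bounded_dist'` with its bound supplied by `hbdd_temperedPiChart_of_tame`): two compatible
vertex systems fixed by a compact `C ≠ 1` are, at every level where they differ, the two ends of a `C`-fixed edge —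
the binder of abc-iut-f-172's `centralizer_le_of_hadj` / `edgeLikeCentralizer_of_hadj`.
[cite: MochizukiSemiAnbd2006, Thm 3.7(iii) p.41] -/
theorem hadj_temperedPiChart_of_tame (h37 : 𝒢.Thm37Hypotheses)
    (hTinf : ∀ w : 𝒢.graph.Vertex, {b | 𝒢.graph.abuts b = some w}.Infinite →
      {b : 𝒢.graph.Branch | 𝒢.graph.abuts b = some w ∧ ∃ b', b' ≠ b ∧ 𝒢.graph.edgeOf b' = 𝒢.graph.edgeOf b ∧
        ∃ w', 𝒢.graph.abuts b' = some w' ∧ {b'' | 𝒢.graph.abuts b'' = some w'}.Infinite}.Finite)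
    (hTmul : ∀ w a : 𝒢.graph.Vertex, {b | 𝒢.graph.abuts b = some w}.Infinite →
      {b : 𝒢.graph.Branch | 𝒢.graph.abuts b = some w ∧ ∃ b', b' ≠ b ∧ 𝒢.graph.edgeOf b' = 𝒢.graph.edgeOf b ∧
        𝒢.graph.abuts b' = some a}.Finite)
    (C : Subgroup (𝒢.temperedPiChart h37.toProp36Hypotheses).G)
    (hCc : IsCompact (C : Set (𝒢.temperedPiChart h37.toProp36Hypotheses).G)) (hC : C ≠ ⊥)
    (x x' : ∀ j, ((verticialLevelData_temperedPiChart (h36 := h37.toProp36Hypotheses)).tree j).Vertex)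
    (hx : ∀ ⦃i j : ℕ⦄ (hij : i ≤ j), ((verticialLevelData_temperedPiChart (h36 := h37.toProp36Hypotheses)).trans hij).vertexMap (x j) = x i)
    (hx' : ∀ ⦃i j : ℕ⦄ (hij : i ≤ j), ((verticialLevelData_temperedPiChart (h36 := h37.toProp36Hypotheses)).trans hij).vertexMap (x' j) = x' i)
    (hfx : ∀ g ∈ C, ∀ j, ((verticialLevelData_temperedPiChart (h36 := h37.toProp36Hypotheses)).act j g).hom.vertexMap (x j) = x j)
    (hfx' : ∀ g ∈ C, ∀ j, ((verticialLevelData_temperedPiChart (h36 := h37.toProp36Hypotheses)).act j g).hom.vertexMap (x' j) = x' j)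
    (j : ℕ) (hne : x j ≠ x' j) :
    ∃ (e : ((verticialLevelData_temperedPiChart (h36 := h37.toProp36Hypotheses)).tree j).Edge)
      (b b' : ((verticialLevelData_temperedPiChart (h36 := h37.toProp36Hypotheses)).tree j).Branch), b ≠ b' ∧
      ((verticialLevelData_temperedPiChart (h36 := h37.toProp36Hypotheses)).tree j).edgeOf b = e ∧
      ((verticialLevelData_temperedPiChart (h36 := h37.toProp36Hypotheses)).tree j).edgeOf b' = e ∧
      ((verticialLevelData_temperedPiChart (h36 := h37.toProp36Hypotheses)).tree j).abuts b = some (x j) ∧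
      ((verticialLevelData_temperedPiChart (h36 := h37.toProp36Hypotheses)).tree j).abuts b' = some (x' j) ∧
      ∀ g ∈ C, ((verticialLevelData_temperedPiChart (h36 := h37.toProp36Hypotheses)).act j g).hom.edgeMap e = e :=
  hadj_temperedPiChart_of_bounded_dist' h37 C hCc hC x x' hx hx' hfx hfx'
    (𝒢.hbdd_temperedPiChart_of_tame h37 hTinf hTmul C hC x x' hx hx' hfx hfx') j hne

/-- **The centraliser of a nontrivial compact subgroup of `π₁^temp(𝒢)` lies in each of its verticial hosts, at
every TAME countable `𝒢`** satisfying the hypotheses of [SemiAnbd] Thm 3.7, for EVERY chart `c` (abc-iut-f-172's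
`centralizer_le_of_hadj` at the level data of `c` transported from the canonical tower, exactly as in
`centralizer_le_verticial_of_isLocallyFinite`, with `hadj_temperedPiChart_of_tame`).
[cite: MochizukiSemiAnbd2006, Thm 3.7(iii) pp.40-41] -/
theorem centralizer_le_verticial_of_tame (h37 : 𝒢.Thm37Hypotheses)
    (hTinf : ∀ w : 𝒢.graph.Vertex, {b | 𝒢.graph.abuts b = some w}.Infinite →
      {b : 𝒢.graph.Branch | 𝒢.graph.abuts b = some w ∧ ∃ b', b' ≠ b ∧ 𝒢.graph.edgeOf b' = 𝒢.graph.edgeOf b ∧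
        ∃ w', 𝒢.graph.abuts b' = some w' ∧ {b'' | 𝒢.graph.abuts b'' = some w'}.Infinite}.Finite)
    (hTmul : ∀ w a : 𝒢.graph.Vertex, {b | 𝒢.graph.abuts b = some w}.Infinite →
      {b : 𝒢.graph.Branch | 𝒢.graph.abuts b = some w ∧ ∃ b', b' ≠ b ∧ 𝒢.graph.edgeOf b' = 𝒢.graph.edgeOf b ∧
        𝒢.graph.abuts b' = some a}.Finite)
    (c : TemperedPiChart 𝒢) (C : Subgroup c.G) (hCc : IsCompact (C : Set c.G)) (hC : C ≠ ⊥)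
    {v : 𝒢.graph.Vertex} {H : Subgroup c.G} (hH : H ∈ verticialSubgroups c v) (hCH : C ≤ H) :
    Subgroup.centralizer (C : Set c.G) ≤ H := by
  obtain ⟨φ, ψ, hψφ, hφψ, hφ, hψ⟩ :=
    TemperedPiChart.exists_compatIso (𝒢.temperedPiChart h37.toProp36Hypotheses) c
  let D₀ := verticialLevelData_temperedPiChart (h36 := h37.toProp36Hypotheses)
  let D : VerticialLevelData.{0} 𝒢 c := D₀.transport φ ψ hψφ hφψ
    (fun v H => mem_verticialSubgroups_iff_map φ hφ ψ hφψ hψ H)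
    (fun e L => mem_edgeLikeSubgroups_iff_map φ hφ ψ hφψ hψ L)
  exact D.centralizer_le_of_hadj verticialDistinct_holds h37 C
    (D₀.hadj_transport φ ψ hψφ hφψ _ _
      (fun C' hC'c hC' x x' hx hx' hfx hfx' j hne' =>
        𝒢.hadj_temperedPiChart_of_tame h37 hTinf hTmul C' hC'c hC' x x' hx hx' hfx hfx' j hne') C hCc hC)
    hH hCH

/-- **(R3c) F-2772 `EdgeLikeCentralizerAt ℋ c` at EVERY chart of EVERY TAME graph of anabelioids `ℋ` satisfying
the hypotheses of [SemiAnbd] Cor. 3.9 — vertices of infinite valence allowed** (p. 43 l. 13 "[again by Theorem 3.7,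
(iii), (iv)]"): the centraliser of the image `ψ(U)` of an open `U ⊆ Π_e` under an edge homomorphism `ψ` at `e` lies
in every verticial subgroup containing it (`ψ(U)` is compact and non-trivial, abc-iut-f-176's
`isCompact_map_and_ne_bot_of_isEdgeHom`).  Every STAR (one vertex of any valence joined by simple edges to vertices
of finite valence, no loop at it) is TAME: both finite sets of the hypotheses are empty or singletons there.
[cite: MochizukiSemiAnbd2006, Cor 3.9 p.43] -/
theorem edgeLikeCentralizerAt_of_tame (hℋ : Cor39Hypotheses ℋ)
    (hTinf : ∀ w : ℋ.graph.Vertex, {b | ℋ.graph.abuts b = some w}.Infinite →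
      {b : ℋ.graph.Branch | ℋ.graph.abuts b = some w ∧ ∃ b', b' ≠ b ∧ ℋ.graph.edgeOf b' = ℋ.graph.edgeOf b ∧
        ∃ w', ℋ.graph.abuts b' = some w' ∧ {b'' | ℋ.graph.abuts b'' = some w'}.Infinite}.Finite)
    (hTmul : ∀ w a : ℋ.graph.Vertex, {b | ℋ.graph.abuts b = some w}.Infinite →
      {b : ℋ.graph.Branch | ℋ.graph.abuts b = some w ∧ ∃ b', b' ≠ b ∧ ℋ.graph.edgeOf b' = ℋ.graph.edgeOf b ∧
        ℋ.graph.abuts b' = some a}.Finite)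
    (c : TemperedPiChart ℋ) : EdgeLikeCentralizerAt ℋ c := by
  intro e ψ hψ U hU v H hH hUH
  obtain ⟨hCc, hC⟩ := isCompact_map_and_ne_bot_of_isEdgeHom hℋ c e ψ hψ U hU
  exact ℋ.centralizer_le_verticial_of_tame hℋ.thm37Hypotheses hTinf hTmul c _ hCc hC hH hUH

/-- **F-2773 `EdgeLikeCentralizer` RESTRICTED to TAME graphs, hypothesis-free**: for every graph of anabelioids
satisfying the hypotheses of [SemiAnbd] Cor. 3.9 whose infinite-valence vertices are TAME (in particular every
locally finite graph, every star, every graph whose infinite-valence vertices are pairwise non-adjacent, loop-free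
and of finite edge multiplicity) and every chart, `EdgeLikeCentralizerAt`.  (The bare ∀-countable fact F-2773
additionally ranges over graphs with an infinitely-branching core, not treated here.)
[cite: MochizukiSemiAnbd2006, Cor 3.9 p.43] -/
theorem edgeLikeCentralizer_of_tame :
    ∀ (ℋ : ProfiniteSemiGraph.{u}), Cor39Hypotheses ℋ →
      (∀ w : ℋ.graph.Vertex, {b | ℋ.graph.abuts b = some w}.Infinite →
        {b : ℋ.graph.Branch | ℋ.graph.abuts b = some w ∧ ∃ b', b' ≠ b ∧ ℋ.graph.edgeOf b' = ℋ.graph.edgeOf b ∧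
          ∃ w', ℋ.graph.abuts b' = some w' ∧ {b'' | ℋ.graph.abuts b'' = some w'}.Infinite}.Finite) →
      (∀ w a : ℋ.graph.Vertex, {b | ℋ.graph.abuts b = some w}.Infinite →
        {b : ℋ.graph.Branch | ℋ.graph.abuts b = some w ∧ ∃ b', b' ≠ b ∧ ℋ.graph.edgeOf b' = ℋ.graph.edgeOf b ∧
          ℋ.graph.abuts b' = some a}.Finite) →
      ∀ (c : TemperedPiChart ℋ), EdgeLikeCentralizerAt ℋ c :=
  fun _ hℋ hTinf hTmul c => edgeLikeCentralizerAt_of_tame hℋ hTinf hTmul c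

/-- **The simplest TAME case spelled out: no infinite-valence vertex meets another one (or itself) along an edge,
and edge multiplicities at infinite-valence vertices are finite** — e.g. a star of any valence with simple edges.
Then (R3c) `EdgeLikeCentralizerAt` holds at every chart. [cite: MochizukiSemiAnbd2006, Cor 3.9 p.43] -/
theorem edgeLikeCentralizerAt_of_isolated_infiniteValence (hℋ : Cor39Hypotheses ℋ)
    (hiso : ∀ (b b' : ℋ.graph.Branch) (w w' : ℋ.graph.Vertex), b' ≠ b → ℋ.graph.edgeOf b' = ℋ.graph.edgeOf b →
      ℋ.graph.abuts b = some w → ℋ.graph.abuts b' = some w' →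
      {b'' | ℋ.graph.abuts b'' = some w}.Infinite → {b'' | ℋ.graph.abuts b'' = some w'}.Finite)
    (hmul : ∀ w a : ℋ.graph.Vertex, {b | ℋ.graph.abuts b = some w}.Infinite →
      {b : ℋ.graph.Branch | ℋ.graph.abuts b = some w ∧ ∃ b', b' ≠ b ∧ ℋ.graph.edgeOf b' = ℋ.graph.edgeOf b ∧
        ℋ.graph.abuts b' = some a}.Finite)
    (c : TemperedPiChart ℋ) : EdgeLikeCentralizerAt ℋ c := by
  refine edgeLikeCentralizerAt_of_tame hℋ (fun w hw => ?_) hmul c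
  convert Set.finite_empty
  ext b
  simp only [Set.mem_setOf_eq, Set.mem_empty_iff_false, iff_false, not_and]
  intro hb ⟨b', hb'b, hb'e, w', hb'w, hw'⟩
  exact hw' (hiso b b' w w' hb'b hb'e hb hb'w hw)

end Canonical

end ProfiniteSemiGraph

end Literature.AnabelianGeometry.SemiGraphs
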